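import Summits.HodgeConjecture.HodgeConjecture.Theorems.K2E3LevelOperatorConjugation   -- ★ p855120 (this seat): `levelOp_mul_of_map_conj_eq`, `coe_levelOp_apply_of_map_conj_eq`, `map_conj_inv_eq_of_map_conj_eq`
import HarnessLib

/-!
# Crux `H413` — K2-LIT E3 «EllipticInputs», U12-h engine L3: the support of Harish-Chandra's partial traces lies on INTERTWINING elements —
# `L_k ∘ (p L_y p) = (p L_y p) ∘ L_{y⁻¹ k y}`, so `tr(p ∘ e_K π(y) e_K ∘ p) ≠ 0` forces a non-zero operator intertwining `k ↦ L_k` with `k ↦ L_{y⁻¹ky}` on `p(V^K)`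

Cell `hodgecm-mathlib`, Track B «K2-LIT», crux item `stmt-HodgeConjecture-24833` (h413), line `K2_E3_EllipticInputs`, socket U12-h `sig_K2E3CharLocConstNearRegular` (‹#9L›, ED. 2
of `…Sigs_U12Characters`; seat K2E3-p09 (g0), dealer K2E3-plan (g1) DEALS BATCH #1 «p09 CONFIRMED self-deal L2+L3»); file L3 of the memo
`K2/K2E3-p09/g0/MEMO-U12a-regular-germ-subskeleton.v1.K2E3-p09-g0.md`, after ★ L2 `K2E3LevelOperatorExpansion` (p855106) and ★ L2′ `K2E3LevelOperatorConjugation` (p855120).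
`--supports stmt-HodgeConjecture-24833 --as helper`.  THEOREMS ONLY — no `def`, no named fact, no instance, no notation, no `sorry`.  GENERIC (any topological group,
any representation over a field of characteristic zero).  HONEST LABEL: HC_CM is proved only modulo the 7 printed citations (2 remaining named inputs: hLiu418 =
stmt-HodgeConjecture-24832, h413 = stmt-HodgeConjecture-24833) until rung 0 closes; count-neutral engine.

THE MATHEMATICS [HarishChandra1999, §14 (interaction ∕ intertwining of `K`-types), §15, and the use on p. 82: «since `d ∈ Φ_ν` we can choose `m ∈ M₀` such that `𝒪_d^{γm} ∩ 𝒪_d ≠ ∅`»,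
i.e. `Θ_d(γ m) ≠ 0 ⇒ γm` intertwines `d` with itself].  In the tree's idiom (★ `levelOp` `L_g = e_K π(g) e_K` on `V^K`, `K` compact open, elements `k` NORMALISING `K` acting by
`L_k = π(k)|_{V^K}`, ★ L2′): for `y ∈ G` and `k` with both `k` and `y⁻¹ k y` normalising `K` (e.g. `k ∈ K₀ ∩ y K₀ y⁻¹`, `K ⊴ K₀`),
  `L_k L_y = L_{ky} = L_y L_{y⁻¹ k y}`   (`levelOp_mul_levelOp_eq_levelOp_mul_conj`),
hence for an idempotent-or-not `p ∈ End(V^K)` commuting with `L_k` and `L_{y⁻¹ky}` (an isotypic projector of `V^K` under `K₀` does),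
  **`L_k ∘ (p L_y p) = (p L_y p) ∘ L_{y⁻¹ k y}`**   (`levelOp_mul_conj_eq_conj_mul_levelOp`):
the operator `B = p L_y p`, whose trace is Harish-Chandra's `Θ_p(y)`, INTERTWINES the two actions `k ↦ L_k` and `k ↦ L_{y⁻¹ k y}` of `K₀ ∩ yK₀y⁻¹`; and `Θ_p(y) ≠ 0 ⇒ B ≠ 0`
(`conj_ne_zero_of_trace_ne_zero`).  With Howe's Cor. 17.2 (memo L5) this becomes `𝒪_d^{y} ∩ 𝒪_d ≠ ∅`.

* `levelOp_mul_of_map_conj_eq_right` (`L_g L_{k′} = L_{g k′}` for `k′` normalising `K`), `levelOp_mul_levelOp_eq_levelOp_mul_conj`,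
  **`levelOp_mul_conj_eq_conj_mul_levelOp`**, `conj_ne_zero_of_trace_ne_zero`.

## References
* [HarishChandra1999] Harish-Chandra (DeBacker–Sally), *Admissible Invariant Distributions on Reductive p-adic Groups*, ULECT 16 (1999): §14, §15, Lemma 19.4 p. 82.
* [BernsteinZelevinsky1976] I. N. Bernstein, A. V. Zelevinsky, Russian Math. Surveys 31:3 (1976), §2.3.
-/

set_option autoImplicit false
-- the mandated namespace repeats `HodgeConjecture.HodgeConjecture`, as in every `Theorems/*.lean` of this sub-problem
set_option linter.dupNamespace false

noncomputable section

open Topology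
open Literature.NumberTheory.Automorphic Literature.NumberTheory.Automorphic.SmoothProjector
open Summit.HodgeConjecture.HodgeConjecture.Cruxes.H413.K2E3LevelOperatorConjugation

namespace Summit.HodgeConjecture.HodgeConjecture.Cruxes.H413.K2E3LevelOperatorIntertwining

variable {k G V : Type*} [Field k] [CharZero k] [Group G] [TopologicalSpace G] [IsTopologicalGroup G] [AddCommGroup V] [Module k V]
  (ρ : Representation k G V) {K : Subgroup G}

/-- **`L_g L_{k′} = L_{g k′}` for `k′` normalising `K`** (`L_{k′} v = π(k′) v ∈ V^K`, so `e_K π(g) e_K (π(k′) v) = e_K π(g k′) v`). [cite: BernsteinZelevinsky1976, §2.3] -/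
theorem levelOp_mul_of_map_conj_eq_right (hKo : IsOpen (K : Set G)) (hKc : IsCompact (K : Set G)) (g : G) {x : G}
    (hx : K.map (MulAut.conj x).toMonoidHom = K) :
    ρ.levelOp hKo hKc g * ρ.levelOp hKo hKc x = ρ.levelOp hKo hKc (g * x) := by
  refine LinearMap.ext fun v => Subtype.ext ?_
  rw [Module.End.mul_apply, Representation.coe_levelOp_apply, coe_levelOp_apply_of_map_conj_eq ρ hKo hKc hx, Representation.coe_levelOp_apply,
    map_mul, Module.End.mul_apply]

/-- **`L_k L_y = L_y L_{y⁻¹ k y}`** when `k` and `y⁻¹ k y` both normalise `K` (both sides are `L_{k y}`). [cite: HarishChandra1999, §14–§15] -/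
theorem levelOp_mul_levelOp_eq_levelOp_mul_conj (hKo : IsOpen (K : Set G)) (hKc : IsCompact (K : Set G)) {x y : G}
    (hx : K.map (MulAut.conj x).toMonoidHom = K) (hxy : K.map (MulAut.conj (y⁻¹ * x * y)).toMonoidHom = K) :
    ρ.levelOp hKo hKc x * ρ.levelOp hKo hKc y = ρ.levelOp hKo hKc y * ρ.levelOp hKo hKc (y⁻¹ * x * y) := by
  rw [levelOp_mul_of_map_conj_eq ρ hKo hKc hx, levelOp_mul_of_map_conj_eq_right ρ hKo hKc y hxy, ← mul_assoc, ← mul_assoc, mul_inv_cancel, one_mul]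

/-- **THE PARTIAL-TRACE OPERATOR INTERTWINES**: for `p ∈ End(V^K)` commuting with `L_k` and with `L_{y⁻¹ k y}` (`k`, `y⁻¹ k y` normalising `K`),
`L_k ∘ (p L_y p) = (p L_y p) ∘ L_{y⁻¹ k y}` — the operator whose trace is Harish-Chandra's `Θ_p(y)` intertwines `k ↦ L_k` with `k ↦ L_{y⁻¹ k y}`.
[cite: HarishChandra1999, §14–§15 and Lemma 19.4 p. 82] -/
theorem levelOp_mul_conj_eq_conj_mul_levelOp (hKo : IsOpen (K : Set G)) (hKc : IsCompact (K : Set G)) {x y : G}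
    (hx : K.map (MulAut.conj x).toMonoidHom = K) (hxy : K.map (MulAut.conj (y⁻¹ * x * y)).toMonoidHom = K)
    {p : Module.End k (ρ.fixedPoints K)} (hp : p * ρ.levelOp hKo hKc x = ρ.levelOp hKo hKc x * p)
    (hp' : p * ρ.levelOp hKo hKc (y⁻¹ * x * y) = ρ.levelOp hKo hKc (y⁻¹ * x * y) * p) :
    ρ.levelOp hKo hKc x * (p * ρ.levelOp hKo hKc y * p) = (p * ρ.levelOp hKo hKc y * p) * ρ.levelOp hKo hKc (y⁻¹ * x * y) := by
  calc ρ.levelOp hKo hKc x * (p * ρ.levelOp hKo hKc y * p)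
        = (ρ.levelOp hKo hKc x * p) * ρ.levelOp hKo hKc y * p := by simp only [mul_assoc]
    _ = p * (ρ.levelOp hKo hKc x * ρ.levelOp hKo hKc y) * p := by rw [← hp]; simp only [mul_assoc]
    _ = p * (ρ.levelOp hKo hKc y * ρ.levelOp hKo hKc (y⁻¹ * x * y)) * p := by rw [levelOp_mul_levelOp_eq_levelOp_mul_conj ρ hKo hKc hx hxy]
    _ = p * ρ.levelOp hKo hKc y * (ρ.levelOp hKo hKc (y⁻¹ * x * y) * p) := by simp only [mul_assoc]
    _ = (p * ρ.levelOp hKo hKc y * p) * ρ.levelOp hKo hKc (y⁻¹ * x * y) := by rw [← hp']; simp only [mul_assoc]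

omit [CharZero k] [TopologicalSpace G] [IsTopologicalGroup G] in
/-- `Θ_p(y) = tr(p L_y p) ≠ 0 ⇒ p L_y p ≠ 0` — Harish-Chandra's «`Θ_d(y) ≠ 0 ⇒ y` intertwines `d`», operator half. [cite: HarishChandra1999, §15] -/
theorem conj_ne_zero_of_trace_ne_zero {W : Type*} [AddCommGroup W] [Module k W] {B : Module.End k W} (h : LinearMap.trace k W B ≠ 0) : B ≠ 0 := by
  rintro rfl
  exact h (map_zero _)

end Summit.HodgeConjecture.HodgeConjecture.Cruxes.H413.K2E3LevelOperatorIntertwining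

end
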